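import Literature.AlgebraicGeometry.Resolution.ArithmeticalThreefoldsCompletionValuesDep
import HarnessLib

/-!
# Cossart–Piltant 2019, Prop. 4.8: the ring of fractions with `K`-finite denominators

Topic: `Literature/AlgebraicGeometry/Resolution` (proofs only; no new notions, no new named
facts). The rank-free monoidal engines of Lemma 4.7 (`head_conclusion_of_principalized_within'`)
and their suppliers along the extension `v̂` (`exists_pow_valuation_le_of_mem_locAtCentre_of_finite_denominators`,
`exists_rel_valuation_of_mem_locAtCentre_of_le`) are stated for an arbitrary subring `C ⊆ K̂₁`
all of whose elements are fractions `x/e`, `x, e ∈ Â`, with `e` `K`-FINITE (`v̂(e) ≤ v(b)` for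
some `b ∈ K^×`). This file records that such a `C` exists containing everything the descent
needs: the image of `Â`, the inverses of the `K`-finite elements of `Â` (in particular of the
non-zero elements of `A`, e.g. `h⁻¹`), hence the local rings of models of `Spec Â` with
`K`-finite denominators (Cossart–Piltant: the local ring `𝒪_{Ŷ,ŷ}` of a model which is an
isomorphism above `Spec Â_g`, `0 ≠ g ∈ A`).

* `exists_subring_finite_denominators` — the subring `T⁻¹Â ⊆ K̂₁`, `T` = the `K`-finite
  elements, in `∃`-form (no definition is introduced).

## Sources

* V. Cossart, O. Piltant, J. Algebra 529 (2019) 268–535 = arXiv:1412.0868, proof of Prop. 4.8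
  with Lemma 4.7 (arXiv v1: Prop. 4.6, pp. 52–53). [CossartPiltant2019]
-/

noncomputable section

namespace Literature.AlgebraicGeometry.Resolution

universe u v w

open IsLocalRing

variable {A : Type u} [CommRing A] [IsLocalRing A]
  {K : Type v} [Field K] [Algebra A K]

/-- **The ring of fractions with `K`-finite denominators.** In the situation of
`valuation_adicCompletion_eq_or_lt` (`ι : K → K̂₁` compatible with `A → Â → K̂₁`, `O'` a
valuation ring of `K̂₁`), there is a subring `C ⊆ K̂₁` whose elements are the fractions `x/e` with
`x, e ∈ Â` and `e` `K`-finite (`v̂(ι b) ≤ v̂(e)` for some `b ∈ K^×`), containing the image of `Â`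
and the inverse of every `K`-finite element of `Â` — in particular `ι(a)⁻¹` for `a ∈ A` non-zero
in `K`. (The `K`-finite elements form a multiplicative set `T ∌ 0`; `C = T⁻¹Â`. In
Cossart–Piltant: it contains `𝒪_{Ŷ,ŷ}` and `h⁻¹`, and on `locAtCentre C O'` the archimedean
comparabilities and rational-rank relations of Lemma 4.7 are available.)
[cite: CossartPiltant2019, proof of Prop. 4.8 with Lemma 4.7 (arXiv v1: Prop. 4.6, pp. 52–53)] -/
theorem exists_subring_finite_denominators
    {K₁ : Type w} [Field K₁] [Algebra (AdicCompletion (maximalIdeal A) A) K₁]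
    (ι : K →+* K₁) (hι : ι.comp (algebraMap A K) =
      (algebraMap (AdicCompletion (maximalIdeal A) A) K₁).comp
        (algebraMap A (AdicCompletion (maximalIdeal A) A)))
    (O' : ValuationSubring K₁) :
    ∃ C : Subring K₁,
      (∀ y ∈ C, ∃ x e : AdicCompletion (maximalIdeal A) A,
        (∃ b : K, b ≠ 0 ∧ O'.valuation (ι b) ≤ O'.valuation (algebraMap _ K₁ e)) ∧
          y * algebraMap _ K₁ e = algebraMap _ K₁ x) ∧
      (∀ x : AdicCompletion (maximalIdeal A) A, algebraMap _ K₁ x ∈ C) ∧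
      (∀ e : AdicCompletion (maximalIdeal A) A,
        (∃ b : K, b ≠ 0 ∧ O'.valuation (ι b) ≤ O'.valuation (algebraMap _ K₁ e)) →
          (algebraMap _ K₁ e)⁻¹ ∈ C) ∧
      (∀ a : A, algebraMap A K a ≠ 0 → (ι (algebraMap A K a))⁻¹ ∈ C) := by
  classical
  set Ah := AdicCompletion (maximalIdeal A) A with hAh
  have hιA : ∀ a : A, algebraMap Ah K₁ (algebraMap A Ah a) = ι (algebraMap A K a) := fun a => by
    have := RingHom.congr_fun hι a
    simpa only [RingHom.comp_apply] using this.symm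
  have hpos : ∀ b : K, b ≠ 0 → 0 < O'.valuation (ι b) := fun b hb =>
    zero_lt_iff.mpr ((Valuation.ne_zero_iff _).mpr ((map_ne_zero ι).mpr hb))
  -- `K`-finiteness of an element of `Â`
  let Fin' : Ah → Prop := fun e =>
    ∃ b : K, b ≠ 0 ∧ O'.valuation (ι b) ≤ O'.valuation (algebraMap Ah K₁ e)
  have hFin1 : Fin' 1 := ⟨1, one_ne_zero, by rw [map_one, map_one, map_one, map_one]⟩
  have hFinmul : ∀ e₁ e₂, Fin' e₁ → Fin' e₂ → Fin' (e₁ * e₂) := by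
    rintro e₁ e₂ ⟨b₁, hb₁, h₁⟩ ⟨b₂, hb₂, h₂⟩
    refine ⟨b₁ * b₂, mul_ne_zero hb₁ hb₂, ?_⟩
    rw [map_mul, map_mul, map_mul, map_mul]
    exact mul_le_mul' h₁ h₂
  have hFin0 : ∀ e, Fin' e → algebraMap Ah K₁ e ≠ 0 := by
    rintro e ⟨b, hb, h⟩ h0
    rw [h0, map_zero] at h
    exact not_lt.mpr h (hpos b hb)
  let C : Subring K₁ :=
    { carrier := {y | ∃ x e : Ah, Fin' e ∧ y * algebraMap Ah K₁ e = algebraMap Ah K₁ x}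
      zero_mem' := ⟨0, 1, hFin1, by rw [map_zero, zero_mul]⟩
      one_mem' := ⟨1, 1, hFin1, by rw [one_mul]⟩
      add_mem' := by
        rintro y₁ y₂ ⟨x₁, e₁, he₁, h₁⟩ ⟨x₂, e₂, he₂, h₂⟩
        refine ⟨x₁ * e₂ + x₂ * e₁, e₁ * e₂, hFinmul _ _ he₁ he₂, ?_⟩
        rw [map_mul, map_add, map_mul, map_mul, ← h₁, ← h₂]
        ring
      neg_mem' := by
        rintro y ⟨x, e, he, h⟩
        exact ⟨-x, e, he, by rw [map_neg, neg_mul, h]⟩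
      mul_mem' := by
        rintro y₁ y₂ ⟨x₁, e₁, he₁, h₁⟩ ⟨x₂, e₂, he₂, h₂⟩
        refine ⟨x₁ * x₂, e₁ * e₂, hFinmul _ _ he₁ he₂, ?_⟩
        rw [map_mul, map_mul, ← h₁, ← h₂]
        ring }
  refine ⟨C, fun y hy => hy, fun x => ⟨x, 1, hFin1, by rw [map_one, mul_one]⟩,
    fun e he => ⟨1, e, he, by rw [map_one, inv_mul_cancel₀ (hFin0 e he)]⟩, fun a ha => ?_⟩
  have hfa : Fin' (algebraMap A Ah a) :=
    ⟨algebraMap A K a, ha, by rw [hιA]⟩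
  refine ⟨1, algebraMap A Ah a, hfa, ?_⟩
  rw [map_one, hιA, inv_mul_cancel₀ ((map_ne_zero ι).mpr ha)]

end Literature.AlgebraicGeometry.Resolution

end
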